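/-
Copyright: publication-cell `pub-balaban` (b2b), seat b2b-balaban-pv06 gen 10.  Literature leaf —
finite-dimensional linear algebra only; every theorem is kernel-proved and tagged [folklore];
NO cited facts, NO new named facts.
-/
import Mathlib.Analysis.Matrix.Spectrum
import Mathlib.Analysis.Matrix.PosDef
import Mathlib.Analysis.Matrix.Order
import Literature.MathematicalPhysics.QuantumFieldTheory.Balaban1983to89.T4TerritoryReflection

/-!
# T4 — background oscillation of a Gaussian block normalisation (`log det` volume law)

Third leaf of the lower-half reduction of the territory comparison E2-rel (b)
(`T4TerritoryComparison.TerritoryLowerBound`; cell records `t4/T4-EST-U5Ea-E2relb.md`,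
GAPS G-pv06g10-1 and G-pv06g10-2).  After `T4TerritoryReflection` (reflection (R), small-field mass (P)) and
`T4CollarDeterminant` (the (a)-half of O2′ = `NormLocality`: conditional normalisation =
block normalisation × collar factor), the located open piece O2′(b) splits into
(b1) an IDENTIFICATION of the re-inserted reference normalisation with a localised conditional
normalisation at some admissible background `U'`, and (b2) a BACKGROUND OSCILLATION bound
`|log Z_T(U) − log Z_T(U')| ≤ c_B · cost + slack_B` for the territory block normalisation
`Z_T(U) = ∫ exp(−½⟨x, A(U) x⟩) dx = (2π)^{N/2} (det A(U))^{−1/2}` between two backgrounds.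

This file proves the KERNEL SHAPE of (b2) in the Gaussian model and the bookkeeping by which it
is consumed; it does NOT touch (b1), the model claim (M), or any estimate of Bałaban's papers.

## Statements (all over `ℝ`, all [folklore])

* `log_det_le_trace_sub_card` : `K` symmetric positive definite ⇒ `log det K ≤ tr K − n`
  (`log x ≤ x − 1` on the spectrum; spectral theorem).
* `log_det_sub_log_det_le` : `M, M'` positive definite ⇒
  `log det M − log det M' ≤ tr (M'⁻¹ (M − M'))` (concavity of `log det`; congruence by the
  functional-calculus square root of `M'`, trace cyclicity — no matrix calculus).
* `dotProduct_inv_mulVec_le`, `inv_diag_le`, `abs_inv_entry_le` : `M ≥ c·1`, `c > 0` ⇒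
  `⟨x, M⁻¹x⟩ ≤ ⟨x, x⟩/c` (completing a square) and `|(M⁻¹)ᵢⱼ| ≤ 1/c` (2 × 2 principal minor).
* `abs_trace_mul_le` : `|tr (P E)| ≤ b Σᵢⱼ|Eᵢⱼ|` from `|Pᵢⱼ| ≤ b`.
* `abs_log_det_sub_log_det_le` (**the volume-of-difference law**) : `M, M' ≥ c·1` ⇒
  `|log det M − log det M'| ≤ (1/c) Σᵢⱼ |Mᵢⱼ − M'ᵢⱼ|`; with `sum_abs_sub_le_of_support`
  (`Σᵢⱼ|Mᵢⱼ − M'ᵢⱼ| ≤ δ · #R` when the matrices differ only on the index-pair set `R`, by at most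
  `δ`) the right-hand side is `(δ/c) · #R` — proportional to the NUMBER OF MATRIX ENTRIES THAT
  CHANGE, i.e. (finite-range forms) to the volume of the region where the backgrounds differ.
* `sqrt_det_div_det_le_exp` : the same for the Gaussian normalisations,
  `Z(M')/Z(M) = √(det M / det M') ≤ exp ((1/(2c)) Σᵢⱼ |Mᵢⱼ − M'ᵢⱼ|)`.
* `normLocality_of_oscillation` : transport of `T4TerritoryReflection.NormLocality` from a
  reference block normalisation `nT'` to the actual one `nT` along a pointwise oscillation bound
  `nT' ≤ exp (c_B · cost + slack_B) · nT`, at the price `(cN, slackN) ↦ (cN + c_B, slackN + slack_B)`.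

## Dictionary and honest scope (a READING, not a theorem)

In the Gaussian-step model of `T4TerritoryReflection` §(M), `M = A_TT(U)` and `M' = A_TT(U')` are the
territory blocks of the step-`n` fluctuation form at the actual and at the re-inserted background;
`c` is a uniform positivity constant and the entries are bounded and of finite range, so
`Σᵢⱼ |Mᵢⱼ − M'ᵢⱼ| ≤ δ · (range)^2 · #(territory bonds where U ≠ U')`, which the cell's bookkeeping
charges once to the pending component's life-span cost (μ_b = 1).  That the printed expansion has
this shape is LOCATED, not used: B12 = [Bałaban, CMP 109 (1987)] p.257 «E^{(j)}(X, U) are analytic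
and gauge invariant functions of U, depending on U restricted to X, and satisfying the inequality
|E^{(j)}(X, U)| ≤ E₀ exp(−κ d_j(X))» ((0.24)–(0.25)), whence the volume bound (0.26)
«≤ E₀ O(1) M^{−4} |T₁^{(k)}| η^{−4}»; p.263 «E^{(j)}(X, g_{j−1}, U, J) is defined and analytic on the
space U^c_j(X, α₀, α₁) … It depends on the configurations restricted to X» with the bound (1.18);
p.269 §3 «Preliminary Analytic Extension» (3.1).  A Lipschitz bound of the localized terms in the
background would be read off analyticity + (1.18) by a Cauchy estimate; the inequality (b2) itself
is NOT PRINTED and this file does not claim it for Bałaban's normalisation factors — it proves the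
finite-dimensional Gaussian statement that such a bound instantiates.  NOT a proof of E2-rel (b);
NOT summit progress.

Design note: this leaf imports `T4TerritoryReflection` (for `NormLocality`) and Mathlib only; the two
auxiliary facts it shares with `T4CollarDeterminant` (positivity from a Loewner lower bound, the
functional-calculus square root) are re-derived inline / privately so that the two leaves are
independent of each other.
-/

open Matrix Finset

namespace Literature.MathematicalPhysics.QuantumFieldTheory.Balaban1983to89.T4LogDetOscillation

section LinearAlgebra

variable {n : Type*} [Fintype n] [DecidableEq n]

open scoped MatrixOrder

/-- Loewner lower bound `c • 1 ≤ S` with `c > 0` makes `S` positive definite. [folklore] -/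
private theorem posDef_of_smul_one_le {S : Matrix n n ℝ} {c : ℝ} (hc : 0 < c)
    (h : c • (1 : Matrix n n ℝ) ≤ S) : S.PosDef := by
  have h' : (S - c • (1 : Matrix n n ℝ)).PosSemidef := Matrix.le_iff.mp h
  have hSh : S.IsHermitian := by
    have h1 : S = (S - c • 1) + c • (1 : Matrix n n ℝ) := by rw [sub_add_cancel]
    rw [h1]
    refine h'.1.add ?_
    change (c • (1 : Matrix n n ℝ))ᴴ = c • 1
    rw [conjTranspose_smul, conjTranspose_one, star_trivial]
  refine PosDef.of_dotProduct_mulVec_pos hSh fun x hx => ?_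
  have hq := h'.dotProduct_mulVec_nonneg x
  rw [sub_mulVec, dotProduct_sub, Matrix.smul_mulVec, one_mulVec, dotProduct_smul] at hq
  have hxx : 0 < star x ⬝ᵥ x := dotProduct_star_self_pos_iff.mpr hx
  have : 0 < c • (star x ⬝ᵥ x) := by rw [smul_eq_mul]; positivity
  linarith


/-- `log det K ≤ tr K − card n` for a real symmetric positive definite `K`
(`log x ≤ x − 1` on the spectrum). [folklore] -/
theorem log_det_le_trace_sub_card {K : Matrix n n ℝ} (hK : K.PosDef) :
    Real.log K.det ≤ K.trace - Fintype.card n := by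
  have hdet : K.det = ∏ i, hK.1.eigenvalues i := by
    simpa using hK.1.det_eq_prod_eigenvalues
  have htr : K.trace = ∑ i, hK.1.eigenvalues i := by
    simpa using hK.1.trace_eq_sum_eigenvalues
  rw [hdet, htr, Real.log_prod (s := Finset.univ) (fun i _ => (hK.eigenvalues_pos i).ne')]
  have hc : (Fintype.card n : ℝ) = ∑ _i : n, (1 : ℝ) := by simp
  rw [hc, ← Finset.sum_sub_distrib]
  exact Finset.sum_le_sum fun i _ => Real.log_le_sub_one_of_pos (hK.eigenvalues_pos i)

/-- Concavity bound: `log det M − log det M' ≤ tr (M'⁻¹ (M − M'))` for real symmetric positive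
definite `M, M'` (congruence by the square root of `M'`, then `log_det_le_trace_sub_card`).
[folklore] -/
theorem log_det_sub_log_det_le {M M' : Matrix n n ℝ} (hM : M.PosDef) (hM' : M'.PosDef) :
    Real.log M.det - Real.log M'.det ≤ (M'⁻¹ * (M - M')).trace := by
  obtain ⟨X, hXpsd, hXX⟩ : ∃ X : Matrix n n ℝ, X.PosSemidef ∧ X * X = M' :=
    ⟨CFC.sqrt M', (CFC.sqrt_nonneg M').posSemidef, CFC.sqrt_mul_sqrt_self M' hM'.posSemidef.nonneg⟩
  have hM'det : M'.det = X.det * X.det := by rw [← hXX, det_mul]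
  have hXdet : X.det ≠ 0 := by
    intro h
    exact hM'.det_pos.ne' (by rw [hM'det, h, mul_zero])
  have hXu : IsUnit X.det := isUnit_iff_ne_zero.mpr hXdet
  have hXherm : Xᴴ = X := hXpsd.1
  set Y : Matrix n n ℝ := X⁻¹ with hY
  have hYherm : Yᴴ = Y := by rw [hY, conjTranspose_nonsing_inv, hXherm]
  have hYu : IsUnit Y := (isUnit_iff_isUnit_det Y).mpr (isUnit_nonsing_inv_det X hXu)
  have hK : (Y * M * Y).PosDef := by
    have hinj : Function.Injective Y.vecMul := Matrix.vecMul_injective_iff_isUnit.mpr hYu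
    have h := hM.mul_mul_conjTranspose_same hinj
    rwa [hYherm] at h
  have h1 := log_det_le_trace_sub_card hK
  have hYX : Y.det * X.det = 1 := det_nonsing_inv_mul_det X hXu
  have hdetK : (Y * M * Y).det = M.det / M'.det := by
    rw [det_mul, det_mul, hM'det, eq_div_iff (mul_ne_zero hXdet hXdet)]
    calc Y.det * M.det * Y.det * (X.det * X.det)
        = (Y.det * X.det) * (Y.det * X.det) * M.det := by ring
      _ = M.det := by rw [hYX]; ring
  have htrK : (Y * M * Y).trace = (M'⁻¹ * M).trace := by
    rw [Matrix.trace_mul_comm, ← Matrix.mul_assoc, hY, ← Matrix.mul_inv_rev, hXX]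
  have hM'u : IsUnit M'.det := (isUnit_iff_isUnit_det M').mp hM'.isUnit
  have htr1 : (M'⁻¹ * (M - M')).trace = (M'⁻¹ * M).trace - Fintype.card n := by
    rw [Matrix.mul_sub, Matrix.trace_sub, nonsing_inv_mul M' hM'u, Matrix.trace_one]
  rw [htr1, ← htrK, ← Real.log_div hM.det_pos.ne' hM'.det_pos.ne', ← hdetK]
  exact h1

/-- Quadratic-form bound for the inverse: `M ≥ c·1` (`c > 0`) gives `⟨x, M⁻¹ x⟩ ≤ ⟨x, x⟩ / c`,
by completing a square (no spectral calculus). [folklore] -/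
theorem dotProduct_inv_mulVec_le {M : Matrix n n ℝ} {c : ℝ} (hc : 0 < c)
    (hM : (M - c • (1 : Matrix n n ℝ)).PosSemidef) (x : n → ℝ) :
    x ⬝ᵥ (M⁻¹ *ᵥ x) ≤ (x ⬝ᵥ x) / c := by
  have hMpd : M.PosDef := posDef_of_smul_one_le hc (Matrix.le_iff.mpr hM)
  have hMu : IsUnit M.det := (isUnit_iff_isUnit_det M).mp hMpd.isUnit
  set y : n → ℝ := M⁻¹ *ᵥ x with hy
  have hMy : M *ᵥ y = x := by
    rw [hy, mulVec_mulVec, mul_nonsing_inv M hMu, one_mulVec]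
  have h1 : c * (y ⬝ᵥ y) ≤ x ⬝ᵥ y := by
    have h := hM.dotProduct_mulVec_nonneg y
    rw [star_trivial, sub_mulVec, dotProduct_sub, hMy, Matrix.smul_mulVec, one_mulVec,
      dotProduct_smul, smul_eq_mul, dotProduct_comm y x] at h
    linarith
  have h2 : 0 ≤ (x - c • y) ⬝ᵥ (x - c • y) := by
    simpa using dotProduct_star_self_nonneg (x - c • y)
  simp only [sub_dotProduct, dotProduct_sub, smul_dotProduct, dotProduct_smul, smul_eq_mul,
    dotProduct_comm y x] at h2
  rw [le_div_iff₀ hc]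
  nlinarith [mul_le_mul_of_nonneg_left h1 hc.le]

/-- Diagonal entries of the inverse: `M ≥ c·1` gives `(M⁻¹) i i ≤ 1 / c`. [folklore] -/
theorem inv_diag_le {M : Matrix n n ℝ} {c : ℝ} (hc : 0 < c)
    (hM : (M - c • (1 : Matrix n n ℝ)).PosSemidef) (i : n) : M⁻¹ i i ≤ 1 / c := by
  have h := dotProduct_inv_mulVec_le hc hM (Pi.single i 1)
  simpa [Matrix.mulVec, dotProduct, Pi.single_apply, Finset.sum_ite_eq', Finset.sum_ite_eq]
    using h

/-- All entries of the inverse: `M ≥ c·1` gives `|(M⁻¹) i j| ≤ 1 / c` (the `2 × 2` principal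
minor of the positive semidefinite `M⁻¹`). [folklore] -/
theorem abs_inv_entry_le {M : Matrix n n ℝ} {c : ℝ} (hc : 0 < c)
    (hM : (M - c • (1 : Matrix n n ℝ)).PosSemidef) (i j : n) : |M⁻¹ i j| ≤ 1 / c := by
  have hMpd : M.PosDef := posDef_of_smul_one_le hc (Matrix.le_iff.mpr hM)
  have hP : M⁻¹.PosSemidef := hMpd.inv.posSemidef
  have hsymm : M⁻¹ j i = M⁻¹ i j := by
    have h := hP.1
    have := congrFun (congrFun h i) j
    simpa [conjTranspose_apply] using this
  have hii := inv_diag_le hc hM i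
  have hjj := inv_diag_le hc hM j
  have h0i : 0 ≤ M⁻¹ i i := hP.diag_nonneg
  have h0j : 0 ≤ M⁻¹ j j := hP.diag_nonneg
  have h2 : 0 ≤ (M⁻¹.submatrix ![i, j] ![i, j]).det := (hP.submatrix _).det_nonneg
  rw [Matrix.det_fin_two] at h2
  simp only [submatrix_apply, Matrix.cons_val_zero, Matrix.cons_val_one] at h2
  rw [hsymm] at h2
  have hsq : (M⁻¹ i j) ^ 2 ≤ (1 / c) ^ 2 := by
    nlinarith [mul_le_mul hii hjj h0j (by positivity : (0:ℝ) ≤ 1 / c)]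
  exact abs_le_of_sq_le_sq hsq (by positivity)

omit [DecidableEq n] in
/-- Trace bound from an entry bound: `|tr (P E)| ≤ b · Σᵢⱼ |Eᵢⱼ|` when `|Pᵢⱼ| ≤ b`. [folklore] -/
theorem abs_trace_mul_le {P E : Matrix n n ℝ} {b : ℝ} (hP : ∀ i j, |P i j| ≤ b) :
    |(P * E).trace| ≤ b * ∑ i, ∑ j, |E i j| := by
  rw [Matrix.trace]
  simp only [Matrix.diag_apply, Matrix.mul_apply]
  calc |∑ i, ∑ j, P i j * E j i|
      ≤ ∑ i, ∑ j, |P i j * E j i| := by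
        refine (Finset.abs_sum_le_sum_abs _ _).trans (Finset.sum_le_sum fun i _ => ?_)
        exact Finset.abs_sum_le_sum_abs _ _
    _ ≤ ∑ i, ∑ j, b * |E j i| := by
        refine Finset.sum_le_sum fun i _ => Finset.sum_le_sum fun j _ => ?_
        rw [abs_mul]
        exact mul_le_mul_of_nonneg_right (hP i j) (abs_nonneg _)
    _ = b * ∑ i, ∑ j, |E i j| := by
        rw [Finset.sum_comm]
        simp only [← Finset.mul_sum]

/-- **Background oscillation of `log det` (volume-of-difference law).** For real symmetric
`M, M' ≥ c·1` (`c > 0`): `|log det M − log det M'| ≤ (1/c) · Σᵢⱼ |Mᵢⱼ − M'ᵢⱼ|`. [folklore] -/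
theorem abs_log_det_sub_log_det_le {M M' : Matrix n n ℝ} {c : ℝ} (hc : 0 < c)
    (hM : (M - c • (1 : Matrix n n ℝ)).PosSemidef) (hM' : (M' - c • (1 : Matrix n n ℝ)).PosSemidef) :
    |Real.log M.det - Real.log M'.det| ≤ (1 / c) * ∑ i, ∑ j, |M i j - M' i j| := by
  have hMpd : M.PosDef := posDef_of_smul_one_le hc (Matrix.le_iff.mpr hM)
  have hM'pd : M'.PosDef := posDef_of_smul_one_le hc (Matrix.le_iff.mpr hM')
  rw [abs_sub_le_iff]
  constructor
  · calc Real.log M.det - Real.log M'.det ≤ (M'⁻¹ * (M - M')).trace :=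
          log_det_sub_log_det_le hMpd hM'pd
      _ ≤ |(M'⁻¹ * (M - M')).trace| := le_abs_self _
      _ ≤ (1 / c) * ∑ i, ∑ j, |(M - M') i j| := abs_trace_mul_le (abs_inv_entry_le hc hM')
      _ = (1 / c) * ∑ i, ∑ j, |M i j - M' i j| := by simp only [Matrix.sub_apply]
  · calc Real.log M'.det - Real.log M.det ≤ (M⁻¹ * (M' - M)).trace :=
          log_det_sub_log_det_le hM'pd hMpd
      _ ≤ |(M⁻¹ * (M' - M)).trace| := le_abs_self _
      _ ≤ (1 / c) * ∑ i, ∑ j, |(M' - M) i j| := abs_trace_mul_le (abs_inv_entry_le hc hM)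
      _ = (1 / c) * ∑ i, ∑ j, |M i j - M' i j| := by simp only [Matrix.sub_apply, abs_sub_comm]

omit [DecidableEq n] in
/-- Localised form: if `M` and `M'` differ only on a set `R` of index pairs, by at most `δ` there,
then `Σᵢⱼ |Mᵢⱼ − M'ᵢⱼ| ≤ δ · #R`. [folklore] -/
theorem sum_abs_sub_le_of_support {M M' : Matrix n n ℝ} {R : Finset (n × n)} {δ : ℝ}
    (hoff : ∀ i j, (i, j) ∉ R → M i j = M' i j)
    (hon : ∀ i j, (i, j) ∈ R → |M i j - M' i j| ≤ δ) :
    ∑ i, ∑ j, |M i j - M' i j| ≤ δ * R.card := by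
  rw [← Finset.sum_product' (f := fun i j => |M i j - M' i j|)]
  have hsub : ∑ p ∈ R, |M p.1 p.2 - M' p.1 p.2|
      = ∑ p ∈ (Finset.univ : Finset n) ×ˢ (Finset.univ : Finset n), |M p.1 p.2 - M' p.1 p.2| := by
    apply Finset.sum_subset (fun p _ => Finset.mem_product.mpr ⟨Finset.mem_univ _, Finset.mem_univ _⟩)
    intro p _ hp
    rw [hoff p.1 p.2 hp, sub_self, abs_zero]
  rw [← hsub]
  calc ∑ p ∈ R, |M p.1 p.2 - M' p.1 p.2| ≤ ∑ _p ∈ R, δ :=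
        Finset.sum_le_sum fun p hp => hon p.1 p.2 hp
    _ = δ * R.card := by rw [Finset.sum_const, nsmul_eq_mul, mul_comm]

/-- Ratio form for Gaussian normalisations `Z(Q) = (2π)^{N/2} (det Q)^{-1/2}`:
`Z(M')/Z(M) = √(det M / det M') ≤ exp ((1/(2c)) Σᵢⱼ |Mᵢⱼ − M'ᵢⱼ|)`. [folklore] -/
theorem sqrt_det_div_det_le_exp {M M' : Matrix n n ℝ} {c : ℝ} (hc : 0 < c)
    (hM : (M - c • (1 : Matrix n n ℝ)).PosSemidef) (hM' : (M' - c • (1 : Matrix n n ℝ)).PosSemidef) :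
    Real.sqrt (M.det / M'.det) ≤ Real.exp (1 / (2 * c) * ∑ i, ∑ j, |M i j - M' i j|) := by
  have hMpd : M.PosDef := posDef_of_smul_one_le hc (Matrix.le_iff.mpr hM)
  have hM'pd : M'.PosDef := posDef_of_smul_one_le hc (Matrix.le_iff.mpr hM')
  have hq : 0 < M.det / M'.det := div_pos hMpd.det_pos hM'pd.det_pos
  have h := abs_log_det_sub_log_det_le hc hM hM'
  have hlog : Real.log (M.det / M'.det) ≤ (1 / c) * ∑ i, ∑ j, |M i j - M' i j| := by
    rw [Real.log_div hMpd.det_pos.ne' hM'pd.det_pos.ne']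
    exact (le_abs_self _).trans h
  rw [Real.sqrt_eq_rpow, Real.rpow_def_of_pos hq]
  apply Real.exp_le_exp.mpr
  have : Real.log (M.det / M'.det) * (1 / 2 : ℝ)
      ≤ (1 / c) * (∑ i, ∑ j, |M i j - M' i j|) * (1 / 2 : ℝ) :=
    mul_le_mul_of_nonneg_right hlog (by norm_num)
  calc Real.log (M.det / M'.det) * (1 / 2 : ℝ)
      ≤ (1 / c) * (∑ i, ∑ j, |M i j - M' i j|) * (1 / 2 : ℝ) := this
    _ = 1 / (2 * c) * ∑ i, ∑ j, |M i j - M' i j| := by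
        field_simp

end LinearAlgebra

section Packaging

open MeasureTheory T4HistoryPeeling T4InsertionProfile T4TerritoryComparison T4TerritoryReflection

variable {ι : Type*} {T : Finset ι} {n : ℕ} {σ : Type*} {Ω : Type*} [MeasurableSpace Ω]
variable {Φ : SwitchOff T n} {Aω : ι → ℝ} {μ : Measure Ω} {F : FibreModel T Aω μ}
  {X : TerritoryFactorisation Φ F} {shape : Fin n → ι → σ} {cost : Fin n → σ → ℝ}

/-- **Transport of `NormLocality` along a background oscillation.** If `NormLocality` holds for a
reference block normalisation `nT'` (e.g. at the re-inserted background) with constants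
`(cN, slackN)`, and the actual block normalisation `nT` satisfies the oscillation bound
`nT' ≤ exp (cB · cost + slackB) · nT` (as delivered pointwise by `sqrt_det_div_det_le_exp` once
`Σ|ΔA| ≤ 2c · (cB · cost + slackB)`), then `NormLocality` holds for `nT` with constants
`(cN + cB, slackN + slackB)`. [folklore] -/
theorem normLocality_of_oscillation {nT nT' : Fin n → ι → Ω → ℝ} {cN cB : ℝ}
    {slackN slackB : Fin n → σ → ℝ}
    (h' : NormLocality Φ X shape cost nT' cN slackN)
    (hosc : ∀ i, ∀ τ ∈ T, Φ.pend i τ = true → ∀ ω,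
      nT' i τ ω ≤ Real.exp (cB * cost i (shape i τ) + slackB i (shape i τ)) * nT i τ ω) :
    NormLocality Φ X shape cost nT (cN + cB) (slackN + slackB) := by
  intro i τ hτ hp ω
  have h1 := h' i τ hτ hp ω
  have h2 := hosc i τ hτ hp ω
  set a := cN * cost i (shape i τ) + slackN i (shape i τ) with ha
  set b := cB * cost i (shape i τ) + slackB i (shape i τ) with hb
  have hsplit : Real.exp (-((cN + cB) * cost i (shape i τ) + (slackN + slackB) i (shape i τ)))
      = Real.exp (-b) * Real.exp (-a) := by
    rw [← Real.exp_add, Pi.add_apply, Pi.add_apply]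
    congr 1
    ring
  rw [hsplit, mul_assoc]
  calc Real.exp (-b) * (Real.exp (-a) * X.norm i τ ω)
      ≤ Real.exp (-b) * nT' i τ ω := mul_le_mul_of_nonneg_left h1 (Real.exp_nonneg _)
    _ ≤ Real.exp (-b) * (Real.exp b * nT i τ ω) := mul_le_mul_of_nonneg_left h2 (Real.exp_nonneg _)
    _ = nT i τ ω := by rw [← mul_assoc, ← Real.exp_add, neg_add_cancel, Real.exp_zero, one_mul]

end Packaging

section Sanity

/-- Sanity (non-vacuity of the hypotheses of the volume law): `M = M' = c • 1` is admissible and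
the bound reads `0 ≤ 0`. -/
example (c : ℝ) (hc : 0 < c) :
    |Real.log ((c • (1 : Matrix (Fin 2) (Fin 2) ℝ)).det) - Real.log ((c • (1 : Matrix (Fin 2) (Fin 2) ℝ)).det)|
      ≤ (1 / c) * ∑ i, ∑ j, |(c • (1 : Matrix (Fin 2) (Fin 2) ℝ)) i j - (c • (1 : Matrix (Fin 2) (Fin 2) ℝ)) i j| :=
  abs_log_det_sub_log_det_le hc (by rw [sub_self]; exact PosSemidef.zero)
    (by rw [sub_self]; exact PosSemidef.zero)

/-- Sanity (the `1 × 1` case of `log det K ≤ tr K − n` is `log k ≤ k − 1`). -/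
example (k : ℝ) (hk : 0 < k) : Real.log k ≤ k - 1 := Real.log_le_sub_one_of_pos hk

end Sanity

end Literature.MathematicalPhysics.QuantumFieldTheory.Balaban1983to89.T4LogDetOscillation
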